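import Mathlib

/-!
# LeviBranching — the weight certificate behind `ρ = 16` on the boundary surface `W₋₁` (solo-blind s47)

On the boundary surface `W₋₁` of the genus-9 `Q₈`-locus of the T₈ face the half-spin Kuga–Satake
factor degenerates to `A₊ ~ (J(C₃) × E₁₇₂₈)²`, whose Hodge group is `Γ = U(W) ≅ U(2,1)` acting on
`H¹(J(C₃) × E₁₇₂₈) ⊗ ℂ = U ⊕ U*` with `U = W ⊕ Δ⁻¹` (`W` the 3-dimensional `ℚ(i)`-eigenspace of
`H¹(J(C₃))`, `Δ = det W`).  The transcendental lattice `T` of the K3 surface is one of the two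
*other* eight-dimensional representations of `𝔰𝔬(U ⊕ U*) ≅ 𝔰𝔬₈`, i.e. `Λ^{ev} U` or `Λ^{odd} U`
restricted to `GL(U) ⊃ Γ` (no half-twist by `det U` is needed because the weights of `U` sum to
zero).  This file certifies, at the level of weight multisets for the maximal torus of `U(W)`
(weights written in `ℤ³`; all proofs by `decide`, no `native_decide`, no extra axioms):

* `ev_hodge`, `odd_hodge`: under the Hodge cocharacter `h = (1,−1,−1)` the representation
  `Λ^{ev} U` has charges `{0⁶, 2, −2}` (K3 type `(1,6,1)`) while `Λ^{odd} U` and `U ⊕ U*` have all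
  charges `±1` (weight-one type).  Hence `T ⊗ ℂ|_Γ = Λ^{ev} U`.
* `ev_weights`: `Λ^{ev} U = 𝟙² ⊕ (W* ⊗ Δ) ⊕ (W ⊗ Δ⁻¹)` as a weight multiset: the zero weight occurs
  exactly twice (`ev_zero_weight`) and the six non-zero weights are `e_j + e_k` and `e_i − Δ`, on
  which the centre of `U(W)` acts with charges `±2` (`ev_central`).  Consequently the space of
  `Γ`-invariants in `T ⊗ ℂ` is 2-dimensional — two new algebraic classes, `ρ = 14 + 2 = 16` — and
  its complement `T₆` carries a non-trivial action of the centre, i.e. CM by `ℚ(i)`.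
* `triality_parity`: for every sign vector `u ∈ {±1}⁴` (every a priori possible Hodge cocharacter
  on a 4-dimensional isotropic `U'`), exactly one of `Λ^{ev} U'`, `Λ^{odd} U'` (charges doubled and
  shifted by `−Σ u`) is of K3 type and the other of weight-one type — the bookkeeping fact that makes
  the identification independent of chirality conventions.

The representation theory these finite computations certify (half-spin representations of
`𝔰𝔬(U ⊕ U*)` are `Λ^{ev/odd} U ⊗ (det U)^{-1/2}`; a sub-Hodge-structure is determined by charges;
invariants lie in the zero weight space) stays on paper: HOME `work/s47/sheets.md` §3(b), claim SB-C382.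
-/

namespace Summit.HodgeConjecture.HodgeConjecture.Theorems.LeviBranching

/-- A weight of the maximal torus of `U(W)`, `W` three-dimensional, in the basis `e₁,e₂,e₃`. -/
abbrev Wt := ℤ × ℤ × ℤ

/-- Sum of a list of weights. -/
def wsum (l : List Wt) : Wt :=
  l.foldr (fun a b => (a.1 + b.1, a.2.1 + b.2.1, a.2.2 + b.2.2)) (0, 0, 0)

/-- Negative of a weight. -/
def wneg (a : Wt) : Wt := (-a.1, -a.2.1, -a.2.2)

/-- Weights of `U = W ⊕ Δ⁻¹`: `e₁, e₂, e₃` and `−(e₁+e₂+e₃)`. -/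
def wU : List Wt := [(1, 0, 0), (0, 1, 0), (0, 0, 1), (-1, -1, -1)]

/-- Weights of `Λ^{ev} U`: sums over sublists of even length (dimension `1 + 6 + 1 = 8`). -/
def wEv : List Wt := (wU.sublists.filter fun s => s.length % 2 = 0).map wsum

/-- Weights of `Λ^{odd} U`: sums over sublists of odd length (dimension `4 + 4 = 8`). -/
def wOdd : List Wt := (wU.sublists.filter fun s => s.length % 2 = 1).map wsum

/-- Weights of `U ⊕ U*` (the representation carrying `H¹(A₊)`). -/
def wUU : List Wt := wU ++ wU.map wneg

/-- Charge of a weight under the Hodge cocharacter `h = (1, −1, −1)`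
(`H^{1,0} ∩ W` one-dimensional, `H^{0,1} ∩ W` two-dimensional). -/
def hodge (a : Wt) : ℤ := a.1 - a.2.1 - a.2.2

/-- Charge of a weight under the centre of `U(W)` (scalars act on `e_i` with charge `1`). -/
def central (a : Wt) : ℤ := a.1 + a.2.1 + a.2.2

/-- `Λ^{ev} U` is eight-dimensional. -/
theorem card_ev : wEv.length = 8 := by decide

/-- `Λ^{odd} U` is eight-dimensional. -/
theorem card_odd : wOdd.length = 8 := by decide

/-- `U ⊕ U*` is eight-dimensional. -/
theorem card_UU : wUU.length = 8 := by decide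

/-- The weights of `U` sum to zero: `det U` is trivial on the torus, so no half-twist is needed. -/
theorem detU_trivial : wsum wU = (0, 0, 0) := by decide

/-- `Λ^{ev} U` is of K3 type `(1,6,1)` under the Hodge cocharacter. -/
theorem ev_hodge :
    (wEv.map hodge).count 2 = 1 ∧ (wEv.map hodge).count 0 = 6 ∧ (wEv.map hodge).count (-2) = 1 := by
  decide

/-- `Λ^{odd} U` is of weight-one type `(4,4)`: all Hodge charges are `±1`. -/
theorem odd_hodge :
    (wOdd.map hodge).count 1 = 4 ∧ (wOdd.map hodge).count (-1) = 4 := by decide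

/-- `U ⊕ U*` is of weight-one type `(4,4)`. -/
theorem UU_hodge :
    (wUU.map hodge).count 1 = 4 ∧ (wUU.map hodge).count (-1) = 4 := by decide

/-- The weight multiset of `Λ^{ev} U` is `{0, 0} ⊎ {e_j + e_k} ⊎ {e_i − (e₁+e₂+e₃)}`, i.e.
`Λ^{ev} U = 𝟙² ⊕ (W* ⊗ Δ) ⊕ (W ⊗ Δ⁻¹)`. -/
theorem ev_weights :
    wEv.Perm [(0, 0, 0), (0, 0, 0), (1, 1, 0), (1, 0, 1), (0, 1, 1),
      (0, -1, -1), (-1, 0, -1), (-1, -1, 0)] := by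
  decide

/-- The zero weight occurs in `Λ^{ev} U` exactly twice (so `dim (T ⊗ ℂ)^Γ ≤ 2`). -/
theorem ev_zero_weight : wEv.count (0, 0, 0) = 2 := by decide

/-- On the non-zero weights of `Λ^{ev} U` the centre of `U(W)` acts with charges `±2` (three each):
the rank-6 complement `T₆` carries a CM action of `ℚ(i)`, the rank-2 part `N₂` is invariant. -/
theorem ev_central :
    (wEv.map central).count 0 = 2 ∧ (wEv.map central).count 2 = 3 ∧
      (wEv.map central).count (-2) = 3 := by
  decide

/-- `Λ^{odd} U = U ⊕ Λ³U = {±e_i, ±(e₁+e₂+e₃)} = W ⊕ W* ⊕ Δ ⊕ Δ⁻¹` as a weight multiset. -/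
theorem odd_weights :
    wOdd.Perm [(1, 0, 0), (0, 1, 0), (0, 0, 1), (-1, -1, -1),
      (-1, 0, 0), (0, -1, 0), (0, 0, -1), (1, 1, 1)] := by
  decide

/-! ## Chirality independence (triality bookkeeping) -/

/-- All sign vectors `u ∈ {±1}⁴`. -/
def signVecs : List (List ℤ) := do
  let a ← [1, -1]; let b ← [1, -1]; let c ← [1, -1]; let d ← [1, -1]
  pure [a, b, c, d]

/-- Doubled, `det^{-1/2}`-shifted charges of `Λ^{par} U'` for a cocharacter with charges `u` on `U'`:
`2 Σ_S u − Σ u` over sublists `S` of the given length parity. -/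
def lamCh (par : ℕ) (u : List ℤ) : List ℤ :=
  (u.sublists.filter fun s => s.length % 2 = par).map fun s => 2 * s.sum - u.sum

/-- K3 type `(1,6,1)` in doubled charges. -/
def isK3 (l : List ℤ) : Bool := l.length = 8 ∧ l.count 0 = 6 ∧ l.count 4 = 1 ∧ l.count (-4) = 1

/-- Weight-one type `(4,4)` in doubled charges. -/
def isWtOne (l : List ℤ) : Bool := l.length = 8 ∧ l.count 2 = 4 ∧ l.count (-2) = 4

/-- For every sign vector exactly one of `Λ^{ev}`, `Λ^{odd}` is of K3 type and the other of
weight-one type. -/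
theorem triality_parity :
    ∀ u ∈ signVecs,
      (isK3 (lamCh 0 u) && isWtOne (lamCh 1 u)) ≠ (isWtOne (lamCh 0 u) && isK3 (lamCh 1 u)) ∧
      ((isK3 (lamCh 0 u) && isWtOne (lamCh 1 u)) || (isWtOne (lamCh 0 u) && isK3 (lamCh 1 u))) := by
  decide

/-- The case of the text: `u = (1,−1,−1,1)` (`U = W ⊕ Δ⁻¹`) puts the K3-type structure on `Λ^{ev}`,
the other admissible pairing `u = (1,−1,−1,−1)` (`U' = W ⊕ Δ`) puts it on `Λ^{odd}`; the resulting
unordered pair of `Γ`-representations is the same. -/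
theorem text_cases :
    isK3 (lamCh 0 [1, -1, -1, 1]) ∧ isWtOne (lamCh 1 [1, -1, -1, 1]) ∧
      isWtOne (lamCh 0 [1, -1, -1, -1]) ∧ isK3 (lamCh 1 [1, -1, -1, -1]) := by
  decide

end Summit.HodgeConjecture.HodgeConjecture.Theorems.LeviBranching
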